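import Literature.MathematicalPhysics.QuantumLattice.LatticeGaugeDLRGibbsProofs
import Literature.MathematicalPhysics.QuantumFieldTheory.LatticeGaugeShenZhuZhuProofs
import Literature.Probability.LatticeModels.GibbsSpecificationDLRProofs
import HarnessLib

/-!
# Lipschitz dependence of the Wilson kernel averages on the coupling, uniformly in the boundary condition

Helper file of crux `FibreToTorus` (stmt-QuantumFields-16244), line `Sketch` (energy programme): for a bounded measurable `F`
(`|F| ≤ C`), a bound `B` on the boundary Wilson action of `Λ`, and couplings with `|b' - b| ≤ 1`,
`|γ^{b'}_Λ F(η) - γ^b_Λ F(η)| ≤ 2 C B e^{4(|b|+1)B} |b' - b|` for every boundary condition `η` — the quantitative form of the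
continuity in the coupling used qualitatively in `kink_mem_ymGibbsMeasures_of_tendsto_coupling` (sibling file `…KinkDLRLimit`).
-/

noncomputable section

open MeasureTheory Filter Topology Finset
open Literature.Probability.LatticeModels (Site glueWith IsGibbsMeasure measurable_glueWith)
open Literature.MathematicalPhysics.QuantumLattice (LGConfig ZdEdge ymGibbsMeasures ymSpecification wilsonBoundaryAction
  continuous_wilsonBoundaryAction continuous_integral_ymSpecification abs_integral_ymSpecification_le integral_ymSpecification
  isProbabilityMeasure_ymSpecification normaliser_pos continuous_integral_glueWith exists_bound_of_continuous integrable_of_bound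
  measurable_ymSpecification_apply continuous_glueWith_prod)
open Literature.MathematicalPhysics.QuantumFieldTheory (haarProbability isSpecification_ymSpecification_of_t2Space)

namespace Summit.QuantumFields.YangMills.Theorems.FibreToTorus

section Coupling

variable {d N : ℕ} {G : Type} [Group G] [TopologicalSpace G] [IsTopologicalGroup G] [CompactSpace G]
  [MeasurableSpace G] [BorelSpace G] [SecondCountableTopology G]

/-- **Lipschitz dependence of the Wilson kernel averages on the coupling, uniformly in the boundary condition**: for a bounded
measurable `F` with `|F| ≤ C`, a bound `B` on `|S_Λ|` (`S_Λ = wilsonBoundaryAction ρ Λ`), and couplings with `|b' - b| ≤ 1`,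
`|γ^{b'}_Λ F(η) - γ^{b}_Λ F(η)| ≤ 2 C B e^{4(|b|+1)B} |b' - b|` for every `η`. [folklore] -/
theorem kernel_coupling_lipschitz (ρ : G →* Matrix (Fin N) (Fin N) ℂ) (hρ : Continuous ρ) (Λ : Finset (ZdEdge d))
    {B : ℝ} (hB : ∀ U : LGConfig d G, |wilsonBoundaryAction ρ Λ U| ≤ B) {F : LGConfig d G → ℝ} (hF : Measurable F)
    {C : ℝ} (hC : ∀ U, |F U| ≤ C) {b b' : ℝ} (hbb : |b' - b| ≤ 1) (η : LGConfig d G) :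
    |(∫ U, F U ∂(ymSpecification ρ b' Λ η)) - ∫ U, F U ∂(ymSpecification ρ b Λ η)| ≤
      2 * C * B * Real.exp (4 * ((|b| + 1) * B)) * |b' - b| := by
  classical
  -- `|e^x - e^y| ≤ e^{max x y} |x - y|` (from `1 + t ≤ e^t`; also in the tree as
  -- `BoseGas.abs_exp_sub_exp_le_exp_max_mul`, not imported here)
  have abs_exp_sub_exp_le : ∀ x y : ℝ, |Real.exp x - Real.exp y| ≤ Real.exp (max x y) * |x - y| := by
    have key : ∀ a c : ℝ, c ≤ a → Real.exp a - Real.exp c ≤ Real.exp a * (a - c) := fun a c hac => by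
      have h := Real.add_one_le_exp (c - a)
      have hexp : Real.exp c = Real.exp a * Real.exp (c - a) := by
        rw [← Real.exp_add]; ring_nf
      rw [hexp]
      nlinarith [Real.exp_pos a, h]
    intro x y
    rcases le_total y x with hyx | hxy
    · rw [max_eq_left hyx, abs_of_nonneg (sub_nonneg.2 (Real.exp_le_exp.2 hyx)), abs_of_nonneg (sub_nonneg.2 hyx)]
      exact key x y hyx
    · rw [max_eq_right hxy, abs_sub_comm, abs_of_nonneg (sub_nonneg.2 (Real.exp_le_exp.2 hxy)), abs_sub_comm,
        abs_of_nonneg (sub_nonneg.2 hxy)]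
      exact key y x hxy
  set π : Measure (↥Λ → G) := Measure.pi fun _ : ↥Λ => haarProbability G with hπ
  haveI : IsProbabilityMeasure π := by rw [hπ]; infer_instance
  set W : (↥Λ → G) → ℝ := fun ζ => wilsonBoundaryAction ρ Λ (glueWith Λ ζ η) with hW
  set Φ : (↥Λ → G) → ℝ := fun ζ => F (glueWith Λ ζ η) with hΦ
  set K : ℝ := (|b| + 1) * B with hK
  have hB0 : 0 ≤ B := (abs_nonneg _).trans (hB (fun _ => 1))
  have hC0 : 0 ≤ C := (abs_nonneg _).trans (hC (fun _ => 1))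
  have hK0 : 0 ≤ K := by positivity
  have hWb : ∀ ζ, |W ζ| ≤ B := fun ζ => hB _
  have hΦb : ∀ ζ, |Φ ζ| ≤ C := fun ζ => hC _
  -- exponents are bounded by `K` for both couplings
  have hb'le : |b'| ≤ |b| + 1 := by
    have := abs_sub_abs_le_abs_sub b' b; linarith
  have hexpb : ∀ (c : ℝ), |c| ≤ |b| + 1 → ∀ ζ, |(-c) * W ζ| ≤ K := fun c hc ζ => by
    rw [abs_mul, abs_neg, hK]
    exact mul_le_mul hc (hWb ζ) (abs_nonneg _) (by positivity)
  have hEb : ∀ (c : ℝ), |c| ≤ |b| + 1 → ∀ ζ, Real.exp (-K) ≤ Real.exp (-c * W ζ) ∧ Real.exp (-c * W ζ) ≤ Real.exp K :=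
    fun c hc ζ => by
      have h := abs_le.1 (hexpb c hc ζ)
      exact ⟨Real.exp_le_exp.2 h.1, Real.exp_le_exp.2 h.2⟩
  have hb_self : |b| ≤ |b| + 1 := by linarith
  -- measurability / integrability of everything in sight
  have hWm : Measurable W := (continuous_wilsonBoundaryAction ρ hρ Λ).measurable.comp (measurable_glueWith Λ η)
  have hΦm : Measurable Φ := hF.comp (measurable_glueWith Λ η)
  have hEm : ∀ c : ℝ, Measurable fun ζ => Real.exp (-c * W ζ) := fun c =>
    Real.measurable_exp.comp (measurable_const.mul hWm)
  have hEi : ∀ c : ℝ, |c| ≤ |b| + 1 → Integrable (fun ζ => Real.exp (-c * W ζ)) π := fun c hc =>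
    integrable_of_bound (hEm c).aestronglyMeasurable (C := Real.exp K) fun ζ => by
      rw [abs_of_pos (Real.exp_pos _)]; exact (hEb c hc ζ).2
  have hNi : ∀ c : ℝ, |c| ≤ |b| + 1 → Integrable (fun ζ => Φ ζ * Real.exp (-c * W ζ)) π := fun c hc =>
    integrable_of_bound (hΦm.mul (hEm c)).aestronglyMeasurable (C := C * Real.exp K) fun ζ => by
      rw [abs_mul, abs_of_pos (Real.exp_pos _)]
      exact mul_le_mul (hΦb ζ) (hEb c hc ζ).2 (Real.exp_pos _).le hC0
  -- the ratio formula
  have hratio : ∀ c : ℝ, ∫ U, F U ∂(ymSpecification ρ c Λ η) =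
      (∫ ζ, Φ ζ * Real.exp (-c * W ζ) ∂π) / ∫ ζ, Real.exp (-c * W ζ) ∂π := fun c =>
    integral_ymSpecification ρ hρ c Λ hF η
  -- numerators and denominators
  set Nb : ℝ := ∫ ζ, Φ ζ * Real.exp (-b * W ζ) ∂π with hNb
  set Nb' : ℝ := ∫ ζ, Φ ζ * Real.exp (-b' * W ζ) ∂π with hNb'
  set Db : ℝ := ∫ ζ, Real.exp (-b * W ζ) ∂π with hDb
  set Db' : ℝ := ∫ ζ, Real.exp (-b' * W ζ) ∂π with hDb'
  -- bounds on the denominators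
  have hDlow : ∀ c : ℝ, |c| ≤ |b| + 1 → Real.exp (-K) ≤ ∫ ζ, Real.exp (-c * W ζ) ∂π := fun c hc => by
    calc Real.exp (-K) = ∫ _ζ, Real.exp (-K) ∂π := by simp
      _ ≤ _ := integral_mono (integrable_const _) (hEi c hc) fun ζ => (hEb c hc ζ).1
  have hDb_pos : 0 < Db := lt_of_lt_of_le (Real.exp_pos _) (hDlow b hb_self)
  have hDb'_pos : 0 < Db' := lt_of_lt_of_le (Real.exp_pos _) (hDlow b' hb'le)
  -- bound on the numerator `|Nb| ≤ C e^K`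
  have hNb_le : |Nb| ≤ C * Real.exp K := by
    refine (abs_integral_le_integral_abs).trans ?_
    calc ∫ ζ, |Φ ζ * Real.exp (-b * W ζ)| ∂π ≤ ∫ _ζ, C * Real.exp K ∂π :=
          integral_mono (hNi b hb_self).norm (integrable_const _) fun ζ => by
            show |Φ ζ * Real.exp (-b * W ζ)| ≤ C * Real.exp K
            rw [abs_mul, abs_of_pos (Real.exp_pos _)]
            exact mul_le_mul (hΦb ζ) (hEb b hb_self ζ).2 (Real.exp_pos _).le hC0
      _ = C * Real.exp K := by simp
  -- the exponential weights differ by at most `e^K B |b' - b|`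
  have hdiffE : ∀ ζ, |Real.exp (-b' * W ζ) - Real.exp (-b * W ζ)| ≤ Real.exp K * B * |b' - b| := fun ζ => by
    refine (abs_exp_sub_exp_le _ _).trans ?_
    have hmax : max (-b' * W ζ) (-b * W ζ) ≤ K :=
      max_le (abs_le.1 (hexpb b' hb'le ζ)).2 (abs_le.1 (hexpb b hb_self ζ)).2
    have hsub : |(-b' * W ζ) - (-b * W ζ)| ≤ B * |b' - b| := by
      have : (-b' * W ζ) - (-b * W ζ) = -((b' - b) * W ζ) := by ring
      rw [this, abs_neg, abs_mul, mul_comm]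
      exact mul_le_mul_of_nonneg_right (hWb ζ) (abs_nonneg _)
    calc Real.exp (max (-b' * W ζ) (-b * W ζ)) * |(-b' * W ζ) - (-b * W ζ)|
        ≤ Real.exp K * (B * |b' - b|) :=
          mul_le_mul (Real.exp_le_exp.2 hmax) hsub (abs_nonneg _) (Real.exp_pos _).le
      _ = Real.exp K * B * |b' - b| := by ring
  have hND : |Nb' - Nb| ≤ C * (Real.exp K * B * |b' - b|) := by
    rw [hNb', hNb, ← integral_sub (hNi b' hb'le) (hNi b hb_self)]
    refine (abs_integral_le_integral_abs).trans ?_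
    calc ∫ ζ, |Φ ζ * Real.exp (-b' * W ζ) - Φ ζ * Real.exp (-b * W ζ)| ∂π
        ≤ ∫ _ζ, C * (Real.exp K * B * |b' - b|) ∂π :=
          integral_mono ((hNi b' hb'le).sub (hNi b hb_self)).norm (integrable_const _) fun ζ => by
            show |Φ ζ * Real.exp (-b' * W ζ) - Φ ζ * Real.exp (-b * W ζ)| ≤ C * (Real.exp K * B * |b' - b|)
            rw [← mul_sub, abs_mul]
            exact mul_le_mul (hΦb ζ) (hdiffE ζ) (abs_nonneg _) hC0
      _ = C * (Real.exp K * B * |b' - b|) := by simp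
  have hDD : |Db' - Db| ≤ Real.exp K * B * |b' - b| := by
    rw [hDb', hDb, ← integral_sub (hEi b' hb'le) (hEi b hb_self)]
    refine (abs_integral_le_integral_abs).trans ?_
    calc ∫ ζ, |Real.exp (-b' * W ζ) - Real.exp (-b * W ζ)| ∂π ≤ ∫ _ζ, Real.exp K * B * |b' - b| ∂π :=
          integral_mono ((hEi b' hb'le).sub (hEi b hb_self)).norm (integrable_const _) fun ζ => hdiffE ζ
      _ = Real.exp K * B * |b' - b| := by simp
  -- combine: `|N'/D' - N/D| ≤ (|N' - N| D + |N| |D - D'|)/(D D')`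
  rw [hratio b', hratio b]
  change |Nb' / Db' - Nb / Db| ≤ 2 * C * B * Real.exp (4 * K) * |b' - b|
  have hfrac : Nb' / Db' - Nb / Db = ((Nb' - Nb) * Db + Nb * (Db - Db')) / (Db' * Db) := by
    field_simp
    ring
  rw [hfrac, abs_div, abs_of_pos (mul_pos hDb'_pos hDb_pos)]
  rw [div_le_iff₀ (mul_pos hDb'_pos hDb_pos)]
  have hDb_le : Db ≤ Real.exp K := by
    calc Db ≤ ∫ _ζ, Real.exp K ∂π := integral_mono (hEi b hb_self) (integrable_const _) fun ζ => (hEb b hb_self ζ).2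
      _ = Real.exp K := by simp
  have hlowprod : Real.exp (-K) * Real.exp (-K) ≤ Db' * Db :=
    mul_le_mul (hDlow b' hb'le) (hDlow b hb_self) (Real.exp_pos _).le hDb'_pos.le
  have hee : Real.exp (-K) * Real.exp (-K) * Real.exp (4 * K) = Real.exp K * Real.exp K := by
    rw [← Real.exp_add, ← Real.exp_add, ← Real.exp_add]; ring_nf
  have hΔ : 0 ≤ |b' - b| := abs_nonneg _
  calc |(Nb' - Nb) * Db + Nb * (Db - Db')|
      ≤ |Nb' - Nb| * Db + |Nb| * |Db - Db'| := by
        refine (abs_add_le _ _).trans (add_le_add ?_ ?_)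
        · rw [abs_mul, abs_of_pos hDb_pos]
        · rw [abs_mul]
    _ ≤ C * (Real.exp K * B * |b' - b|) * Real.exp K + C * Real.exp K * (Real.exp K * B * |b' - b|) := by
        refine add_le_add (mul_le_mul hND hDb_le hDb_pos.le (by positivity)) ?_
        rw [abs_sub_comm] at hDD
        exact mul_le_mul hNb_le hDD (abs_nonneg _) (by positivity)
    _ = 2 * C * B * |b' - b| * (Real.exp K * Real.exp K) := by ring
    _ ≤ 2 * C * B * |b' - b| * (Db' * Db * Real.exp (4 * K)) := by
        refine mul_le_mul_of_nonneg_left ?_ (by positivity)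
        rw [← hee]
        exact mul_le_mul_of_nonneg_right hlowprod (Real.exp_pos _).le
    _ = 2 * C * B * Real.exp (4 * K) * |b' - b| * (Db' * Db) := by ring

/-- **Registered form (helper sub-goal `kernel_coupling_lipschitz_closed`)**: Lipschitz dependence of the Wilson kernel
averages on the coupling, uniformly in the boundary condition, closed over all parameters. [folklore] -/
theorem kernel_coupling_lipschitz_closed : ∀ (d N : ℕ) (G : Type) [Group G] [TopologicalSpace G] [IsTopologicalGroup G] [CompactSpace G] [MeasurableSpace G] [BorelSpace G] [SecondCountableTopology G] (ρ : G →* Matrix (Fin N) (Fin N) ℂ), Continuous ρ → ∀ (Λ : Finset (ZdEdge d)) (B : ℝ), (∀ U : LGConfig d G, |wilsonBoundaryAction ρ Λ U| ≤ B) → ∀ (F : LGConfig d G → ℝ), Measurable F → ∀ (C : ℝ), (∀ U, |F U| ≤ C) → ∀ (b b' : ℝ), |b' - b| ≤ 1 → ∀ (η : LGConfig d G), |(∫ U, F U ∂(ymSpecification ρ b' Λ η)) - ∫ U, F U ∂(ymSpecification ρ b Λ η)| ≤ 2 * C * B * Real.exp (4 * ((|b| + 1) * B)) * |b' - b| :=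
  fun _ _ _ _ _ _ _ _ _ _ ρ hρ Λ _ hB _ hF _ hC _ _ hbb η => kernel_coupling_lipschitz ρ hρ Λ hB hF hC hbb η

end Coupling

end Summit.QuantumFields.YangMills.Theorems.FibreToTorus

end
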